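import Summits.HodgeConjecture.HodgeConjecture.Theorems.F0P3XiRigid                          -- ★ U♭ `memXiFamily_rigid` (needs an irreducible smooth finite component)
import Summits.HodgeConjecture.HodgeConjecture.Theorems.F0P3AutomorphicFlathAdmissibleOfCot  -- ★ `exists_irreducible_admissible_hasFinComponent_of_isCot` (a cotangent `P` has one)
import HarnessLib

/-!
# U♭ ON THE COTANGENT LOCUS, σ-FREE: the ξ-local family of a cotangent-type discrete `P` determines `ξ`
# (line LH1, organ (β) `memXiFamily_rigid_of_isCot`; GO 500 half A, h413)

Cell `hodgecm-mathlib`, FLOOR 0, crux H413 = `stmt-HodgeConjecture-24833`, route of record `HCCMUnconditional` (no route verbs); line LH1 (SEATPLAN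
«GO 500» v1 §1B; dealer LH1-plan (g0), DEAL 2026-09-02T02:06:30Z (β) to LH1-p02), pay-down skeleton
`F0/P3c/LH1/LH1-plan/g0/StubS2sharp.paydown.skeleton.v1.lean` c17c91f28f62a480 for the closer stub `stub_S2sharp :
Literature.NumberTheory.Rogawski1990.cohDiscrete_memXiFamily_archPinned` (`Cruxes/H413/Lines/F0_U3LettersRung1.lean` ED. 38 :64).
THEOREMS ONLY (no `def`, no instance, no notation, no named fact, no `sorry`); never imports a `Cruxes/…/Lines` module;
`--supports stmt-HodgeConjecture-24833`.

WHAT.  The skeleton's two archimedean organs PIN-ι (`S2PinIotaLetter`) and PIN-τ (`S2PinCompactLetter`) are stated in the `∀ ξ`-form «EVERY `ξ` with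
`MemXiFamily P … ξ` is pinned»; they are print-true because the ξ-local family of a discrete `P` WITH A FINITE COMPONENT determines `ξ` — in-house U♭
★ `F0P3XiRigid.memXiFamily_rigid` (local half ★ `F0P3XiLocalLabelsOfMemXiFamily` = Zelevinsky rigidity of the split member's labels; global half ★
`OneDimAutRepH.ext_of_exists_bc_localComponent_eq_of_split` = weak approximation for `U(1)`).  This file discharges U♭'s finite-component hypothesis
`P.HasFinComponent σ` (`σ` irreducible smooth) ON THE COTANGENT LOCUS: a hol∕antihol-cotangent `P` at a compact CM frame HAS an irreducible admissible
finite component (★ `F0P3AutomorphicFlathAdmissibleOfCot.exists_irreducible_admissible_hasFinComponent_of_isCot`, «AFA» in-house on the cotangent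
locus), and admissible ⇒ smooth (★ `Representation.IsAdmissible.isSmooth`).  RESULT `memXiFamily_rigid_of_isCot`: at the letters' frame
`(L ι H T hT) hdef h2 (μ) (μω hμu)`, for every cotangent `P` and all `ξ ξ′`, `MemXiFamily P … ξ → MemXiFamily P … ξ′ → ξ = ξ′`; `memXiFamily_rigid_of_isCot_cm`
is the same as ONE closed frame-universal statement (the shape the skeleton's letter texts quantify over).  CONSUMER: LH1-p01's EQUIVALENCE CERTIFICATE
`Theorems/F0P3cS2SharpOrgansOfS2Sharp.lean` (S2♯ ⇒ PIN-ι, S2♯ ⇒ PIN-τ: S2♯'s pinned `ξ₀` IS any `ξ` of the family).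

HONEST LABEL.  HC_CM is proved only modulo the 7 printed citations (2 remaining: hLiu418 = stmt-HodgeConjecture-24832, h413 = stmt-HodgeConjecture-24833)
until rung 0 closes; this file closes NO print letter (in-house glue for the pay-down of #80 S2♯).

## References
* [Rogawski1990] J. Rogawski, *Automorphic Representations of Unitary Groups in Three Variables*, Ann. of Math. Stud. 123 (1990): §13.1 p. 199 (`Π(ξ)` indexed by
  `ξ`), §12.2 pp. 173–174 (the split member), §4.13 Lemma 4.13.1 (b), §14.5 p. 237.
* [Zelevinsky1980] A. Zelevinsky, *Induced representations of reductive p-adic groups II*, Ann. Sci. ÉNS 13 (1980), Thm. 4.2.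
* [FlathCorvallis1979] D. Flath, *Decomposition of representations into tensor products*, PSPM 33.1 (1979), Thm. 3.
* [PlatonovRapinchuk1994] V. Platonov, A. Rapinchuk, *Algebraic Groups and Number Theory* (1994), §7.3 Prop. 7.8.
-/

set_option autoImplicit false
-- the mandated namespace repeats `HodgeConjecture.HodgeConjecture`, as in every `Theorems/*.lean` of this sub-problem
set_option linter.dupNamespace false

noncomputable section

open NumberField IsDedekindDomain MeasureTheory
open Literature.NumberTheory.Rogawski1990 Literature.NumberTheory.GaloisRepresentations
open Literature.NumberTheory.Automorphic Literature.NumberTheory.Automorphic.UnitaryGroup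
open Literature.NumberTheory.Automorphic.UnitaryGroup.CotangentForms
open scoped Matrix ComplexOrder

namespace Summit.HodgeConjecture.HodgeConjecture.Cruxes.H413.F0P3cMemXiFamilyRigidOfCot

section Frame

variable {L : Type} [Field L] [NumberField L] [IsCMField L] (ι : L →+* ℂ) (H : Matrix (Fin 3) (Fin 3) L) (T : GL (Fin 3) ℂ)
  (hT : (T : Matrix (Fin 3) (Fin 3) ℂ)ᴴ * H.map ι * (T : Matrix (Fin 3) (Fin 3) ℂ) = Literature.Geometry.ComplexHyperbolic.BallModel.J)
  {μ : Measure (adelicGroupData (↥(maximalRealSubfield L)) L (IsCMField.complexConj L) 3 H).automorphicQuotient}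
  [(adelicGroupData (↥(maximalRealSubfield L)) L (IsCMField.complexConj L) 3 H).IsAutomorphicMeasure μ]

/-- **U♭ AT COTANGENT TYPE (σ-free).**  At a compact CM frame (`hdef`: `H` definite at the complex places off `ι`; `h2`: `[L⁺:ℚ] ≥ 2`), a discrete
automorphic `P` of `U(H)` of holomorphic or antiholomorphic cotangent type at `ι` lies in the ξ-local family (★ `MemXiFamily`) of AT MOST ONE
one-dimensional automorphic `ξ` of `H = U(2) × U(1)`: `MemXiFamily P … ξ → MemXiFamily P … ξ′ → ξ = ξ′`.  PROOF: ★ `memXiFamily_rigid` at the irreducible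
admissible (hence smooth) finite component of ★ `exists_irreducible_admissible_hasFinComponent_of_isCot`.
[cite: Rogawski1990, §13.1 p. 199; §12.2 pp. 173–174; §14.5 p. 237] [cite: Zelevinsky1980, Thm. 4.2] [cite: FlathCorvallis1979, Thm. 3] [cite: PlatonovRapinchuk1994, §7.3 Prop. 7.8] -/
theorem memXiFamily_rigid_of_isCot
    (hdef : ∀ τ' : L →+* ℂ, InfinitePlace.mk τ' ≠ InfinitePlace.mk ι → (H.map τ').PosDef) (h2 : 2 ≤ Module.finrank ℚ ↥(maximalRealSubfield L))
    (μω : HeckeCharacter L) (hμu : μω.IsUnitary)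
    (P : DiscreteAutomorphicRep (adelicGroupData (↥(maximalRealSubfield L)) L (IsCMField.complexConj L) 3 H) μ)
    (hP : P.IsHolCotangentAt (cmArchSection L ι H T hT) (cmCompactFactor L ι H T hT) ∨
      P.IsAntiholCotangentAt (cmArchSection L ι H T hT) (cmCompactFactor L ι H T hT))
    (ξ ξ' : OneDimAutRepH L)
    (h : MemXiFamily P (transpose_map_cmConjRingHom_eq_of_frame L ι H T hT) (isUnit_det_of_frame L ι H T hT) μω hμu ξ)
    (h' : MemXiFamily P (transpose_map_cmConjRingHom_eq_of_frame L ι H T hT) (isUnit_det_of_frame L ι H T hT) μω hμu ξ') : ξ = ξ' := by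
  obtain ⟨W, _, _, σ, hirr, hadm, hPσ⟩ :=
    F0P3AutomorphicFlathAdmissibleOfCot.exists_irreducible_admissible_hasFinComponent_of_isCot ι T hT hdef h2 P hP
  exact F0P3XiRigid.memXiFamily_rigid (transpose_map_cmConjRingHom_eq_of_frame L ι H T hT) (isUnit_det_of_frame L ι H T hT) P hirr
    hadm.isSmooth hPσ μω hμu ξ ξ' h h'

/-- **Uniqueness packaging**: a cotangent `P` that lies in SOME ξ-local family lies in the family of a UNIQUE `ξ` (`∃!`). [cite: Rogawski1990, §13.1 p. 199] [cite: Zelevinsky1980, Thm. 4.2] -/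
theorem existsUnique_memXiFamily_of_isCot
    (hdef : ∀ τ' : L →+* ℂ, InfinitePlace.mk τ' ≠ InfinitePlace.mk ι → (H.map τ').PosDef) (h2 : 2 ≤ Module.finrank ℚ ↥(maximalRealSubfield L))
    (μω : HeckeCharacter L) (hμu : μω.IsUnitary)
    (P : DiscreteAutomorphicRep (adelicGroupData (↥(maximalRealSubfield L)) L (IsCMField.complexConj L) 3 H) μ)
    (hP : P.IsHolCotangentAt (cmArchSection L ι H T hT) (cmCompactFactor L ι H T hT) ∨
      P.IsAntiholCotangentAt (cmArchSection L ι H T hT) (cmCompactFactor L ι H T hT))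
    (hex : ∃ ξ : OneDimAutRepH L, MemXiFamily P (transpose_map_cmConjRingHom_eq_of_frame L ι H T hT) (isUnit_det_of_frame L ι H T hT) μω hμu ξ) :
    ∃! ξ : OneDimAutRepH L, MemXiFamily P (transpose_map_cmConjRingHom_eq_of_frame L ι H T hT) (isUnit_det_of_frame L ι H T hT) μω hμu ξ := by
  obtain ⟨ξ, hξ⟩ := hex
  exact ⟨ξ, hξ, fun ξ' hξ' => memXiFamily_rigid_of_isCot ι H T hT hdef h2 μω hμu P hP ξ' ξ hξ' hξ⟩

end Frame

/-- **U♭ AT COTANGENT TYPE, frame-universal closed form** (the binder telescope of the LH1 skeleton's letter texts `S2PinIotaLetter` ∕ `S2PinCompactLetter`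
up to `P`, then `∀ ξ ξ′`): for every letters' frame `(L ι H T hT) hdef h2 (μ) (μω hμu)`, every hol∕antihol-cotangent discrete `P` and all `ξ ξ′`,
`MemXiFamily P … ξ → MemXiFamily P … ξ′ → ξ = ξ′`. [cite: Rogawski1990, §13.1 p. 199; §12.2 pp. 173–174] [cite: Zelevinsky1980, Thm. 4.2] [cite: FlathCorvallis1979, Thm. 3] -/
theorem memXiFamily_rigid_of_isCot_cm :
    ∀ (L : Type) [Field L] [NumberField L] [IsCMField L] (ι : L →+* ℂ) (H : Matrix (Fin 3) (Fin 3) L) (T : GL (Fin 3) ℂ)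
      (hT : (T : Matrix (Fin 3) (Fin 3) ℂ)ᴴ * H.map ι * (T : Matrix (Fin 3) (Fin 3) ℂ) = Literature.Geometry.ComplexHyperbolic.BallModel.J),
      (∀ τ' : L →+* ℂ, InfinitePlace.mk τ' ≠ InfinitePlace.mk ι → (H.map τ').PosDef) →
      2 ≤ Module.finrank ℚ ↥(maximalRealSubfield L) →
      ∀ (μ : Measure (adelicGroupData (↥(maximalRealSubfield L)) L (IsCMField.complexConj L) 3 H).automorphicQuotient)
        [(adelicGroupData (↥(maximalRealSubfield L)) L (IsCMField.complexConj L) 3 H).IsAutomorphicMeasure μ]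
        (μω : HeckeCharacter L) (hμu : μω.IsUnitary)
        (P : DiscreteAutomorphicRep (adelicGroupData (↥(maximalRealSubfield L)) L (IsCMField.complexConj L) 3 H) μ),
        (P.IsHolCotangentAt (cmArchSection L ι H T hT) (cmCompactFactor L ι H T hT) ∨
          P.IsAntiholCotangentAt (cmArchSection L ι H T hT) (cmCompactFactor L ι H T hT)) →
        ∀ ξ ξ' : OneDimAutRepH L,
          MemXiFamily P (transpose_map_cmConjRingHom_eq_of_frame L ι H T hT) (isUnit_det_of_frame L ι H T hT) μω hμu ξ →
            MemXiFamily P (transpose_map_cmConjRingHom_eq_of_frame L ι H T hT) (isUnit_det_of_frame L ι H T hT) μω hμu ξ' → ξ = ξ' :=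
  fun _ _ _ _ ι H T hT hdef h2 _ _ μω hμu P hP ξ ξ' h h' => memXiFamily_rigid_of_isCot ι H T hT hdef h2 μω hμu P hP ξ ξ' h h'

end Summit.HodgeConjecture.HodgeConjecture.Cruxes.H413.F0P3cMemXiFamilyRigidOfCot

end
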